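import Mathlib
import Summits.KontsevichZagierPeriods.Zeta5Search.ClusterValuationPairs
import HarnessLib

/-!
# The LEMMA-D BONUS: a digit-free sharpening `LB + 1` of the Casoratian class bound (gen-2 g8, REPORT-gen2-g8 §3.9)

HONEST FRAMING: systematic search; no irrationality claim unless certified.  Statement file staged by the gen-2 planner for the
typer; nothing here is proved in Lean (one `@[conjecture]` Prop and three computable definitions).

THE STATEMENT.  Let `m = min E_x` over the multipole classes of `b` modulo a window prime `p ≤ d(b)`.  Suppose every single-pole
class `y` has `ν_y > m` and `m ≤ −3` (so `LB(b,p) = casLB b p = 3 + 2m`, REPORT §3.7), and suppose that the MINIMAL multipole classes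
(`E_x = m`), after discarding the non-self-conjugate ones whose exponent vector is palindromic with `E_x` even, all have the same
exponent vector up to reversal (and are all self-conjugate or all not).  Then `v_p(Cas_j(b)) ≥ LB + 1`.

WHY (paper, REPORT §3.9; modulo the leading-digit recipe of §3.3 = Theorems A/B, `ClassVBound` and the shift rule of g7 §2.5): for
`p ≤ d` the Ω-bracket vanishes and `Cas_j = −Σ_{x,y} (𝒦_x(b⁺)V_y(b) − 𝒦_x(b)V_y(b⁺))`; only pairs of minimal multipole classes reach
the order `p^{3+2m}`, and their joint digit is `D = Σ_{P<Q} (γ_P² − γ_Q²)(c_P v_Q − c_Q v_P)` over conjugate pairs / the self-conjugate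
class (LEMMA D, §3.3).  Even-palindromic pairs have `c_P = v_P = 0`; classes of one exponent type have proportional aggregates
(the leading digits are universal functions of the type times the common unit `ḡ_x`), so `D = 0`.

EVIDENCE (exact rational arithmetic, gen-2 g8 scripts `lbsharp.py`, `lbsharp2.py`, `lbsharpQ.py`, `raysharpcheck.py`): every polytope
vector with `b₀ ≤ 12`, every window prime, every admissible `j`: the hypotheses hold at 5,719 pairs `(b,p)` (33,267 triples `(b,p,j)`)
and `v_p(Cas_j) ≥ LB + 1` in ALL of them (slack histogram from 1 up to 8); along the census rays (exact valuations against the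
scale-free relaxation of §3.8): record `n ≤ 7` (227 points, 32 firing), X1 `n ≤ 5` (177, 41), X2/X3 `n ≤ 4`, row 6 `n ≤ 6`,
symmetric row `n ≤ 60` — 0 violations.  The analogous bonus for `minorQ = U·W′ − U′·W` (with `UB = 5 + m` attained by minimal multipole
classes only) holds in 14,440/14,440 triples (`b₀ ≤ 11`); there is NO such bonus for `minorPhat` (1,746 tight cases).
-/

open Finset
open Summit.KontsevichZagierPeriods.Zeta5Search.WedgeDictionary (dOf)
open Summit.KontsevichZagierPeriods.Zeta5Search.CasoratianValuation (InPolytope shift casoratian)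

namespace Summit.KontsevichZagierPeriods.Zeta5Search.ClusterValuation

/-- The EXPONENT VECTOR (type) of the class of `x` modulo `p`: the net exponents of its points `x₀ < x₀ + p < …` in increasing order
(zeros `+1`, poles `< 0`, neutral points `0`, the even centre's extra `+1` included by `netExp`); the list of the points of
`classSet b p x` in increasing order. -/
def expVector (b : ℕ → ℤ) (p x : ℕ) : List ℤ :=
  ((List.range ((b 0).toNat + 1)).filter fun s => s % p = x % p).map (netExp b)

/-- (Boolean test.) A minimal class is DROPPED from the first digit when it is not self-conjugate, its exponent vector is palindromic and `E_x` is
even: its conjugate-pair aggregates `c_P`, `v_P` vanish (REPORT-gen2-g8 §3.3, symmetric pairs). -/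
def droppedPair (b : ℕ → ℤ) (p x : ℕ) : Bool :=
  decide (¬ CentreIn b p x ∧ expVector b p x = (expVector b p x).reverse ∧ Even (classExp b p x))

/-- (Boolean test.) Two classes have the SAME TYPE: both or neither self-conjugate, and equal exponent vectors up to reversal (conjugation
`q ↦ b₀ − q` reverses the vector). -/
def sameType (b : ℕ → ℤ) (p x y : ℕ) : Bool :=
  decide ((CentreIn b p x ↔ CentreIn b p y) ∧ (expVector b p x = expVector b p y ∨ expVector b p x = (expVector b p y).reverse))

/-- **THE LEMMA-D BONUS (THEOREM LB♯♯ of REPORT-gen2-g8 §3.9; paper proof modulo the §3.3 leading-digit recipe; exhaustively verified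
`b₀ ≤ 12`, 33,267 triples, and pointwise on the census rays — see the module docstring)**: one exponent type among the (non-dropped)
minimal multipole classes forces the `p^{3+2m}` digit of the Casoratian to vanish: `v_p(Cas_j(b)) ≥ casLB b p + 1`. -/
@[conjecture] def LemmaDBonus : Prop :=
  ∀ (b : ℕ → ℤ) (j p : ℕ) (m : ℤ), InPolytope b → 1 ≤ j → j ≤ 7 → InPolytope (shift b j) →
    p.Prime → 5 ≤ p → (p : ℤ) ≤ b 0 → (p : ℤ) ≤ dOf b → (b 0 + 2 : ℤ) < (p : ℤ) ^ 2 →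
    (∃ x ∈ multipoleClasses b p, classExp b p x = m) →
    (∀ x ∈ multipoleClasses b p, m ≤ classExp b p x) →
    (∀ y, y < p → classPoleCount b p y = 1 → m ≤ -3 ∧ m < classNu b p y) →
    (∀ x ∈ multipoleClasses b p, ∀ y ∈ multipoleClasses b p, classExp b p x = m → classExp b p y = m →
        droppedPair b p x = false → droppedPair b p y = false → sameType b p x y = true) →
    casoratian b j ≠ 0 → casLB b p + 1 ≤ padicValRat p (casoratian b j)

/-! ### Sanity of the definitions on the X1 direction `b = (61; 22,21,20,19,18,17,16)`, `p = 19` (REPORT §3.9: the census's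
unexplained cell `(18n, 20n]` at `n = 1`; minimal classes `x = 1, 3` (a conjugate pair, `E = −8`), `LB = −13`, true `v_19(Cas_j) = −12`). -/

/-- The X1 direction at `n = 1`. -/
def bX1 : ℕ → ℤ := fun i => (([61, 22, 21, 20, 19, 18, 17, 16] : List ℤ).getD i 0)

example : expVector bX1 19 1 = [1, -4, -6, 1] := by decide
example : expVector bX1 19 3 = [1, -6, -4, 1] := by decide
example : classExp bX1 19 1 = -8 ∧ classExp bX1 19 3 = -8 ∧ classExp bX1 19 2 = -7 := by decide
example : sameType bX1 19 1 3 = true ∧ droppedPair bX1 19 1 = false := by decide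
example : casLB bX1 19 = -13 := by decide

end Summit.KontsevichZagierPeriods.Zeta5Search.ClusterValuation
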